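import Summits.AtomisticToContinuum.HydrodynamicLimit.Theorems.CollisionIsometryCLTMacroClosureGaussCellMGFA
import HarnessLib

/-!
# The sub-unit-tilt Gaussian cell MGF is bounded (input of `stub_blockMGF_twoScale`, line `IdeatorTwoGen1Sketch`,
crux `MacroClosure`, stmt-AtomisticToContinuum-14870)

Proof file (`--supports stmt-AtomisticToContinuum-14870`) for the registered stub `Barycentric.stub_gaussCellMGF`: for `n + 1`
i.i.d. `N(u, θ id)` velocities, `E exp(γ'(n+1) k) ≤ K(γ')` for `n ≥ n₀(γ')`, where
`(n+1) k = (SS + D)/(2θ) − (3(n+1)/2)(1 + log(SS/(3(n+1)θ)))`, `SS = Σ‖vᵢ‖² − ‖Σvᵢ‖²/(n+1)`,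
`D = ‖Σvᵢ − (n+1)u‖²/(n+1)`. Writing the integrand as `e^{γ'B} · W` with the block Bregman density
`B = SS/(2θ) − (3(n+1)/2)(1 + log(SS/(3(n+1)θ)))` and the drift weight `W = e^{γ'D/(2θ)}`, part A
(`…GaussCellMGFA.lean`, `stub_gaussCellMGF_levelset`, from the landed JOINT Laplace transform
`stub_blockMGF_cochran` by one cold and one hot Chernoff bound) gives the level-set bound
`∫_{t ≤ B⁺} W ≤ 2e^{3/2}(1−γ')^{−3/2} e^{−t·n/(n+1)}`. Here we slice `e^{γ'B}` along the unit levels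
of `B` (`e^{γ'b} ≤ Σ_k e^{γ'(k+1)} 𝟙{k ≤ b⁺}`, `lintegral_exp_mul_le_of_levelsets`, Tonelli for series)
and sum the geometric series `Σ_k e^{γ'(k+1) − k n/(n+1)}`, which converges with ratio
`≤ e^{−(1−γ')/2}` as soon as `n + 1 ≥ 2/(1−γ')` (the threshold `n₀ = ⌈2/(1−γ')⌉`): the constant is
`K = 2e^{3/2}(1−γ')^{−3/2} e^{γ'}/(1 − e^{−(1−γ')/2})`, uniform in `n ≥ n₀`, `u` and `θ > 0`.
-/

noncomputable section

open MeasureTheory Filter Set Topology InformationTheory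
open scoped ENNReal ContDiff

namespace Summit.AtomisticToContinuum.HydrodynamicLimit.Theorems.MacroClosureLine

open Literature.MathematicalPhysics.KineticTheory Literature.Analysis.FluidPDE
open Literature.Analysis.FunctionSpaces


namespace Barycentric

namespace GaussCellMGF

/-- **Unit slicing of an exponential moment by level sets.** If `B` and `W ≥ 0` are measurable and
the `W`-masses of the level sets `{k ≤ B⁺}` (`k ∈ ℕ`) are at most `C₁ e^{−ka}` with `a ≥ γ' + δ`,
`γ' ≥ 0`, `δ > 0`, then `∫ e^{γ'B} W ≤ C₁ e^{γ'}/(1 − e^{−δ})`: pointwise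
`e^{γ'b} ≤ Σ_k e^{γ'(k+1)} 𝟙{k ≤ b⁺}` (take `k = ⌊b⁺⌋`), Tonelli for series, geometric series. [folklore] -/
theorem lintegral_exp_mul_le_of_levelsets {Ω : Type*} [MeasurableSpace Ω] (μ : Measure Ω)
    {B : Ω → ℝ} {W : Ω → ℝ≥0∞} (hB : Measurable B) (hW : Measurable W) {γ' a δ C₁ : ℝ}
    (hγ0 : 0 ≤ γ') (hδ : 0 < δ) (ha : γ' - a ≤ -δ) (hC₁ : 0 ≤ C₁)
    (hlevel : ∀ k : ℕ, ∫⁻ v in {v | (k : ℝ) ≤ max (B v) 0}, W v ∂μ ≤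
      ENNReal.ofReal (C₁ * Real.exp (-(k * a)))) :
    ∫⁻ v, ENNReal.ofReal (Real.exp (γ' * B v)) * W v ∂μ ≤
      ENNReal.ofReal (C₁ * Real.exp γ' * (1 - Real.exp (-δ))⁻¹) := by
  set r : ℝ := Real.exp (-δ) with hr
  have hr0 : 0 < r := Real.exp_pos _
  have hr1 : r < 1 := Real.exp_lt_one_iff.2 (by linarith)
  set E : ℕ → Set Ω := fun k => {v | (k : ℝ) ≤ max (B v) 0} with hE
  have hEm : ∀ k, MeasurableSet (E k) := fun k =>
    measurableSet_le measurable_const (hB.max measurable_const)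
  set c : ℕ → ℝ≥0∞ := fun k => ENNReal.ofReal (Real.exp (γ' * ((k : ℝ) + 1))) with hc
  -- pointwise slicing along the unit levels of `B`
  have hpt : ∀ v, ENNReal.ofReal (Real.exp (γ' * B v)) * W v ≤ ∑' k, c k * (E k).indicator W v := by
    intro v
    set k₀ : ℕ := ⌊max (B v) 0⌋₊ with hk₀
    have hmem : v ∈ E k₀ := by
      rw [hE]
      simp only [Set.mem_setOf_eq]
      exact Nat.floor_le (le_max_right _ _)
    calc ENNReal.ofReal (Real.exp (γ' * B v)) * W v ≤ c k₀ * (E k₀).indicator W v := by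
          rw [Set.indicator_of_mem hmem, hc]
          refine mul_le_mul_left (ENNReal.ofReal_le_ofReal (Real.exp_le_exp.2 ?_)) _
          refine mul_le_mul_of_nonneg_left ?_ hγ0
          have h1 := Nat.lt_floor_add_one (max (B v) 0)
          have h2 := le_max_left (B v) 0
          rw [← hk₀] at h1
          linarith
      _ ≤ ∑' k, c k * (E k).indicator W v := ENNReal.le_tsum k₀
  calc ∫⁻ v, ENNReal.ofReal (Real.exp (γ' * B v)) * W v ∂μ
      ≤ ∫⁻ v, ∑' k, c k * (E k).indicator W v ∂μ := lintegral_mono hpt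
    _ = ∑' k, ∫⁻ v, c k * (E k).indicator W v ∂μ :=
        lintegral_tsum fun k => ((hW.indicator (hEm k)).const_mul (c k)).aemeasurable
    _ = ∑' k, c k * ∫⁻ v in E k, W v ∂μ := by
        congr 1
        funext k
        rw [lintegral_const_mul' _ _ ENNReal.ofReal_ne_top, lintegral_indicator (hEm k)]
    _ ≤ ∑' k : ℕ, c k * ENNReal.ofReal (C₁ * Real.exp (-(k * a))) :=
        ENNReal.tsum_le_tsum fun k => mul_le_mul_right (hlevel k) _
    _ ≤ ∑' k : ℕ, ENNReal.ofReal (C₁ * Real.exp γ' * r ^ k) := by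
        refine ENNReal.tsum_le_tsum fun k => ?_
        rw [hc]
        dsimp only
        rw [← ENNReal.ofReal_mul (Real.exp_pos _).le]
        refine ENNReal.ofReal_le_ofReal ?_
        rw [hr, ← Real.exp_nat_mul]
        have e1 : Real.exp (γ' * ((k : ℝ) + 1)) * (C₁ * Real.exp (-(k * a))) =
            C₁ * Real.exp (γ' * ((k : ℝ) + 1) + -(k * a)) := by
          rw [Real.exp_add]; ring
        have e2 : C₁ * Real.exp γ' * Real.exp ((k : ℝ) * -δ) = C₁ * Real.exp (γ' + (k : ℝ) * -δ) := by
          rw [Real.exp_add]; ring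
        rw [e1, e2]
        refine mul_le_mul_of_nonneg_left (Real.exp_le_exp.2 ?_) hC₁
        have hk : (0 : ℝ) ≤ k := Nat.cast_nonneg k
        have h1 : (k : ℝ) * (γ' - a) ≤ k * -δ := mul_le_mul_of_nonneg_left ha hk
        linarith
    _ = ENNReal.ofReal (∑' k : ℕ, C₁ * Real.exp γ' * r ^ k) :=
        (ENNReal.ofReal_tsum_of_nonneg (fun k => by positivity)
          ((summable_geometric_of_lt_one hr0.le hr1).mul_left _)).symm
    _ = ENNReal.ofReal (C₁ * Real.exp γ' * (1 - r)⁻¹) := by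
        rw [tsum_mul_left, tsum_geometric_of_lt_one hr0.le hr1]

end GaussCellMGF

/-- **The sub-unit-tilt Gaussian cell MGF is bounded** (registered stub `stub_gaussCellMGF`): for
`0 < γ' < 1` there are `K` and `n₀` such that for all `n ≥ n₀`, all drifts `u` and temperatures
`θ > 0`, the `(n+1)`-fold Gaussian product `N(u, θ id)^{⊗(n+1)}` satisfies
`∫ exp(γ'[(SS + ‖Σvᵢ − (n+1)u‖²/(n+1))/(2θ) − (3(n+1)/2)(1 + log(SS/(3(n+1)θ)))]) ≤ K`,
`SS = Σ‖vᵢ‖² − ‖Σvᵢ‖²/(n+1)` — i.e. the exponential moment of `γ'(n+1)×` the kinetic Bregman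
density of a block of `n + 1` particles is bounded uniformly in the block size once
`n + 1 ≥ 2/(1 − γ')`. Explicitly `K = 2e^{3/2}(1−γ')^{−3/2}e^{γ'}/(1 − e^{−(1−γ')/2})`,
`n₀ = ⌈2/(1−γ')⌉`. [folklore] -/
theorem stub_gaussCellMGF : ∀ γ' : ℝ, 0 < γ' → γ' < 1 → ∃ (K : ℝ) (n₀ : ℕ), ∀ n : ℕ, n₀ ≤ n →
    ∀ (u : V3) (θ : ℝ), 0 < θ →
    ∫⁻ v, ENNReal.ofReal (Real.exp (γ' *
        ((((∑ i, ‖v i‖ ^ 2) - ‖∑ i, v i‖ ^ 2 / ((n : ℝ) + 1)) +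
            ‖(∑ i, v i) - ((n : ℝ) + 1) • u‖ ^ 2 / ((n : ℝ) + 1)) / (2 * θ) -
          3 * ((n : ℝ) + 1) / 2 *
            (1 + Real.log (((∑ i, ‖v i‖ ^ 2) - ‖∑ i, v i‖ ^ 2 / ((n : ℝ) + 1)) / (3 * ((n : ℝ) + 1) * θ))))))
      ∂(Measure.pi fun _ : Fin (n + 1) => gaussMeasure u θ) ≤ ENNReal.ofReal K := by
  intro γ' hγ0 hγ1
  refine ⟨2 * Real.exp (3 / 2) * (1 - γ') ^ (-(3 : ℝ) / 2) * Real.exp γ' *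
    (1 - Real.exp (-((1 - γ') / 2)))⁻¹, ⌈2 / (1 - γ')⌉₊, fun n hn u θ hθ => ?_⟩
  have hN0 : (0 : ℝ) < (n : ℝ) + 1 := by positivity
  -- the rate margin `n/(n+1) − γ' ≥ (1 − γ')/2`
  have hNγ : 2 / (1 - γ') ≤ (n : ℝ) + 1 := by
    have h1 : (2 / (1 - γ') : ℝ) ≤ (⌈2 / (1 - γ')⌉₊ : ℕ) := Nat.le_ceil _
    have h2 : ((⌈2 / (1 - γ')⌉₊ : ℕ) : ℝ) ≤ n := by exact_mod_cast hn
    linarith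
  have hrate : γ' - n / ((n : ℝ) + 1) ≤ -((1 - γ') / 2) := by
    rw [div_le_iff₀ (by linarith : (0 : ℝ) < 1 - γ')] at hNγ
    have e : (n : ℝ) / ((n : ℝ) + 1) = 1 - 1 / ((n : ℝ) + 1) := by
      field_simp
      ring
    rw [e]
    have : 1 / ((n : ℝ) + 1) ≤ (1 - γ') / 2 := by
      rw [div_le_div_iff₀ hN0 two_pos]
      linarith
    linarith
  -- measurability of the Bregman density `B` and of the drift weight `W`
  have hSSc : Continuous fun v : Fin (n + 1) → V3 =>
      (∑ i, ‖v i‖ ^ 2) - ‖∑ i, v i‖ ^ 2 / ((n : ℝ) + 1) := by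
    fun_prop
  have hBm : Measurable fun v : Fin (n + 1) → V3 =>
      ((∑ i, ‖v i‖ ^ 2) - ‖∑ i, v i‖ ^ 2 / ((n : ℝ) + 1)) / (2 * θ) -
        3 * ((n : ℝ) + 1) / 2 * (1 + Real.log (((∑ i, ‖v i‖ ^ 2) - ‖∑ i, v i‖ ^ 2 / ((n : ℝ) + 1)) /
          (3 * ((n : ℝ) + 1) * θ))) := by
    have hf : Measurable fun s : ℝ => s / (2 * θ) -
        3 * ((n : ℝ) + 1) / 2 * (1 + Real.log (s / (3 * ((n : ℝ) + 1) * θ))) := by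
      fun_prop
    exact hf.comp hSSc.measurable
  have hWm : Measurable fun v : Fin (n + 1) → V3 => ENNReal.ofReal (Real.exp
      (γ' * ‖(∑ i, v i) - ((n : ℝ) + 1) • u‖ ^ 2 / (2 * θ * ((n : ℝ) + 1)))) := by
    refine (Continuous.measurable ?_).ennreal_ofReal
    fun_prop
  -- slice along the levels of `B`, the level sets being priced by part A
  have h := GaussCellMGF.lintegral_exp_mul_le_of_levelsets
    (Measure.pi fun _ : Fin (n + 1) => gaussMeasure u θ)
    hBm hWm hγ0.le (by linarith : (0 : ℝ) < (1 - γ') / 2) hrate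
    (by positivity : (0 : ℝ) ≤ 2 * Real.exp (3 / 2) * (1 - γ') ^ (-(3 : ℝ) / 2))
    fun k => stub_gaussCellMGF_levelset γ' hγ1 n u θ hθ k (Nat.cast_nonneg k)
  refine le_trans (le_of_eq (lintegral_congr fun v => ?_)) h
  rw [← ENNReal.ofReal_mul (Real.exp_pos _).le, ← Real.exp_add]
  congr 2
  field_simp
  ring

end Barycentric

end Summit.AtomisticToContinuum.HydrodynamicLimit.Theorems.MacroClosureLine

end
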